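import Mathlib
import HarnessLib
import Literature.Probability.Percolation.QuadCrossingSquareModel
import Literature.Barriers.CriticalPhenomena.EmbeddingModulusUniquenessProofs
import Literature.Probability.RandomPlanarGeometry.ConformalRectangleProofs
import Literature.Probability.RandomPlanarGeometry.ChordalCurveFamily
import Literature.Probability.RandomPlanarGeometry.DiamondShearChart
import Literature.Probability.RandomPlanarGeometry.UniformizingArcCorrespondence
import Literature.Probability.RandomPlanarGeometry.MoebiusMatching

/-!
# Crux `SegmentOpen` (stmt-CriticalPhenomena-5471), line `Sketch` — stub `stub_rectUniformization`

**Every conformal rectangle is conformally equivalent to a rectangle with the vertices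
corresponding** (Ahlfors, *Conformal Invariants* (1973), Ch. 4; Lehto–Virtanen, I §2.4;
Pommerenke (1992), §2.3 Exercise 2), in the form consumed by the Dirichlet-principle route to
`ShearCrossRatioAnalytic`: for every conformal rectangle `R` with a uniformizing datum `(φ, x)`
there are a model rectangle `S = rectQuad 0 w 0 h` (here `w = 1`) with `λ(i h/w) = crossRatio x`
and a conformal equivalence `ψ : S.carrier → R.carrier` whose boundary values carry the bottom
side `S.arc 0` into `R.arc 0` and the top side `S.arc 2` into `R.arc 2`, the inverse doing the
same backwards.

Proof. (1) `h` with `λ(ih) = crossRatio x ∈ (0,1)` exists by the intermediate value theorem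
(`exists_lamR_eq`: `λ(it)` is continuous on `(0,∞)`, tends to `0` at `+∞` and
`λ(i/t) = 1 - λ(it)`). (2) Every uniformizing datum of `S` has cross-ratio `λ(i h/w)`
(`rectQuad_crossRatio_eq_lamR`: the similarity `z ↦ -iz + iw` carries `S` onto the corner-marked
rectangle of `rectangle_crossRatio_eq_lamR`, and the cross-ratio is invariant under univalent
maps, `ConformalRectangle.crossRatio_eq_of_image_data`). (3) Both `S` and `R` carry uniformizing
data `(φ_S, ξ)`, `(φ_R, y)` with the two-sided arc correspondence
(`MarkedDomain.exists_uniformizing_arcCorrespondence`, `UniformizingArcCorrespondence.lean`: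
Riemann mapping + Carathéodory); `crossRatio ξ = λ(ih/w) = crossRatio x = crossRatio y` by (2)
and conformal invariance (`crossRatio_eq_of_isUniformizing_holds`). (4) The matching lemma
`exists_moebius_match` (`MoebiusMatching.lean`) gives a real Möbius automorphism `M` of `ℍₒ`
(`exists_moebius_conformalEquiv`, `HalfPlaneMoebius.lean`) carrying `[ξ₀, ξ₁]` into `[y₀, y₁]`
and `[ξ₂, ξ₃]` into `[y₂, y₃]` off its pole, and backwards. (5) `ψ = φ_R ∘ M ∘ φ_S⁻¹`; its
boundary values are composed from the three pieces (`moebius_tendsto_ofReal` for the middle one).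

## References

* L. V. Ahlfors, *Conformal Invariants* (1973), Ch. 4 (extremal length; the rectangle).
* Ch. Pommerenke, *Boundary Behaviour of Conformal Maps* (1992), Thm. 2.6, Cor. 2.7, §2.3 Ex. 2.
* P. Kleban, D. Zagier, *Crossing probabilities and modular forms*, J. Stat. Phys. 113 (2003), §3.
-/

noncomputable section

namespace Summit.CriticalPhenomena.CardyFormulaZ2.Theorems

open Literature.Probability Literature.Barriers.CriticalPhenomena
open Literature.Probability.RandomPlanarGeometry (ConformalRectangle ConformalEquiv MarkedDomain)
open Filter Set Topology MeasureTheory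
open UpperHalfPlane (upperHalfPlaneSet)

section AspectRatio

open RandomPlanarGeometry.KlebanZagier

/-- **Every modulus in `(0,1)` is `λ(im)` for some aspect ratio `m > 0`**: `t ↦ λ(it)` is
continuous on `(0, ∞)` (`hasDerivAt_lamR`), tends to `0` at `+∞` (`tendsto_lamR_atTop`) and
satisfies `λ(i/t) = 1 - λ(it)` (`lamR_inv`), so it takes values below `η` at a large `b` and
above `η` at `1/b`; conclude by the intermediate value theorem. -/
theorem exists_lamR_eq {η : ℝ} (hη : η ∈ Ioo (0 : ℝ) 1) : ∃ m : ℝ, 0 < m ∧ lamR m = η := by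
  have hε : 0 < min η (1 - η) := lt_min hη.1 (by linarith [hη.2])
  obtain ⟨b, hb0, hbε⟩ : ∃ b : ℝ, 0 < b ∧ lamR b < min η (1 - η) := by
    have h1 : ∀ᶠ t in atTop, lamR t < min η (1 - η) := tendsto_lamR_atTop (Iio_mem_nhds hε)
    exact ((eventually_gt_atTop 0).and h1).exists
  have hb1 : lamR b < η := hbε.trans_le (min_le_left _ _)
  have hb2 : η < lamR b⁻¹ := by
    rw [lamR_inv hb0]
    have := min_le_right η (1 - η)
    linarith
  have hpos : ∀ t ∈ uIcc b⁻¹ b, 0 < t := fun t ht => by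
    rcases mem_uIcc.1 ht with h | h
    · exact (inv_pos.2 hb0).trans_le h.1
    · exact hb0.trans_le h.1
  have hcont : ContinuousOn lamR (uIcc b⁻¹ b) :=
    continuousOn_of_forall_continuousAt fun t ht => (hasDerivAt_lamR (hpos t ht)).continuousAt
  obtain ⟨m, hm, hmη⟩ := intermediate_value_uIcc hcont (Icc_subset_uIcc' ⟨hb1.le, hb2.le⟩)
  exact ⟨m, hpos m hm, hmη⟩

end AspectRatio

section ModelRectangle

open Complex Literature.Probability.RandomPlanarGeometry Literature.Probability.Percolation

/-- **The Cardy cross-ratio of the model rectangle.** Every uniformizing datum of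
`rectQuad 0 w 0 h` (corners `0, w, w + ih, ih` marked counterclockwise from `0`, read off the
side descriptions `mem_rectQuad_arc_*`) has cross-ratio `λ(i h/w)`: the similarity
`z ↦ -iz + iw` carries it onto the rectangle `(0,h) × (0,w)` with the corner marking
`(iw, 0, h, h + iw)` of `rectangle_crossRatio_eq_lamR` (Kleban–Zagier 2003, §3), and the
cross-ratio is invariant under univalent maps of the closure
(`ConformalRectangle.crossRatio_eq_of_image_data`). -/
theorem rectQuad_crossRatio_eq_lamR {w h : ℝ} (hw : 0 < w) (hh : 0 < h)
    (φ : ConformalEquiv upperHalfPlaneSet (rectQuad 0 w 0 h hw hh).carrier) (x : Fin 4 → ℝ)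
    (hu : (rectQuad 0 w 0 h hw hh).IsUniformizing φ x) :
    crossRatio x = KlebanZagier.lamR (h / w) := by
  set Q := rectQuad 0 w 0 h hw hh with hQ
  -- the corners of the model rectangle (adapted from `exists_diamond_shear_chart`)
  have a0 : Q.pt 0 ∈ Q.arc 0 := Q.pt_mem_arc_self 0
  have a1 : Q.pt 1 ∈ Q.arc 1 := Q.pt_mem_arc_self 1
  have a2 : Q.pt 2 ∈ Q.arc 2 := Q.pt_mem_arc_self 2
  have a3 : Q.pt 3 ∈ Q.arc 3 := Q.pt_mem_arc_self 3
  have b3 : Q.pt 0 ∈ Q.arc 3 := by simpa using Q.pt_succ_mem_arc 3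
  have b0 : Q.pt 1 ∈ Q.arc 0 := by simpa using Q.pt_succ_mem_arc 0
  have b1 : Q.pt 2 ∈ Q.arc 1 := by simpa using Q.pt_succ_mem_arc 1
  have b2 : Q.pt 3 ∈ Q.arc 2 := by simpa using Q.pt_succ_mem_arc 2
  rw [mem_rectQuad_arc_zero] at a0 b0
  rw [mem_rectQuad_arc_one] at a1 b1
  rw [mem_rectQuad_arc_two] at a2 b2
  rw [mem_rectQuad_arc_three] at a3 b3
  have p0 : Q.pt 0 = 0 := by
    apply Complex.ext <;> simp [a0.1, b3.1]
  have p1 : Q.pt 1 = w := by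
    apply Complex.ext <;> simp [a1.1, b0.1]
  have p2 : Q.pt 2 = w + h * I := by
    apply Complex.ext <;> simp [a2.1, b1.1]
  have p3 : Q.pt 3 = h * I := by
    apply Complex.ext <;> simp [a3.1, b2.1]
  -- the similarity `g z = -i z + i w` (rotation by `-π/2`, then translation by `iw`)
  set g : ℂ → ℂ := fun z => -I * z + I * w with hg
  have hcont : Continuous g := by rw [hg]; fun_prop
  have hdiff : Differentiable ℂ g := by rw [hg]; fun_prop
  have hinj : Function.Injective g := by
    intro z z' hzz'
    have e : -I * z = -I * z' := add_right_cancel hzz'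
    exact mul_left_cancel₀ (neg_ne_zero.2 I_ne_zero) e
  have key : ∀ u : ℂ, g u = ⟨u.im, w - u.re⟩ := fun u => by
    apply Complex.ext
    · simp [hg]
    · simp [hg]; ring
  obtain ⟨S', hS'c, hS'p⟩ := Q.exists_image g hcont.continuousOn hinj.injOn
  have hS'c' : S'.carrier = (Ioo (0 : ℝ) h ×ℂ Ioo (0 : ℝ) w) := by
    rw [hS'c, hQ, rectQuad_carrier]
    ext z
    simp only [mem_image, key, Complex.mem_reProdIm, mem_Ioo]
    constructor
    · rintro ⟨u, ⟨⟨h1, h2⟩, h3, h4⟩, rfl⟩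
      refine ⟨⟨?_, ?_⟩, ?_, ?_⟩ <;> dsimp only <;> linarith
    · rintro ⟨⟨h1, h2⟩, h3, h4⟩
      refine ⟨⟨w - z.im, z.re⟩, ⟨⟨?_, ?_⟩, ?_, ?_⟩, ?_⟩
      · dsimp only; linarith
      · dsimp only; linarith
      · dsimp only; linarith
      · dsimp only; linarith
      · apply Complex.ext
        · rfl
        · show w - (w - z.im) = z.im
          ring
  have hS'p' : S'.pt 0 = (w : ℂ) * Complex.I ∧ S'.pt 1 = 0 ∧ S'.pt 2 = (h : ℂ) ∧
      S'.pt 3 = (h : ℂ) + (w : ℂ) * Complex.I := by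
    refine ⟨?_, ?_, ?_, ?_⟩
    · rw [hS'p, p0, key]; apply Complex.ext <;> simp
    · rw [hS'p, p1, key]; apply Complex.ext <;> simp
    · rw [hS'p, p2, key]; apply Complex.ext <;> simp
    · rw [hS'p, p3, key]; apply Complex.ext <;> simp
  obtain ⟨ψ, y, hψ⟩ := MarkedDomain.exists_isUniformizing_holds S'
  rw [← rectangle_crossRatio_eq_lamR S' hh hw hS'c' hS'p' ψ y hψ]
  exact ConformalRectangle.crossRatio_eq_of_image_data hdiff.differentiableOn hinj.injOn
    hcont.continuousOn hS'c hS'p hu hψ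

end ModelRectangle

/-- **Rectangle uniformization with vertex and side correspondence** (Ahlfors, *Conformal
Invariants* (1973), Ch. 4; Pommerenke (1992), §2.3 Exercise 2: "every quadrilateral is
conformally equivalent to a rectangle, the vertices corresponding"). For every conformal
rectangle `R` with uniformizing datum `(φ, x)` there are `w, h > 0` with
`λ(i h/w) = crossRatio x` and a conformal equivalence `ψ` of the model rectangle
`rectQuad 0 w 0 h` onto `R.carrier` such that: every point of the bottom side `arc 0` (resp. the
top side `arc 2`) of the model rectangle is carried by the boundary values of `ψ` to a point of
`R.arc 0` (resp. `R.arc 2`), and every point of `R.arc 0` (resp. `R.arc 2`) is carried by the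
boundary values of `ψ⁻¹` to a point of the bottom (resp. top) side. Proof: `w = 1`, `h` by the
intermediate value theorem for `λ`; `ψ = φ_R ∘ M ∘ φ_S⁻¹` for uniformizing data of `S` and `R`
with arc correspondence (`MarkedDomain.exists_uniformizing_arcCorrespondence`) and the Möbius
matching `M` of their real marks (`exists_moebius_match`), possible since the two data have the
same cross-ratio `λ(ih) = crossRatio x`. -/
theorem stub_rectUniformization :
    ∀ (R : ConformalRectangle) (φ : ConformalEquiv upperHalfPlaneSet R.carrier) (x : Fin 4 → ℝ),
      R.IsUniformizing φ x →
      ∃ (w h : ℝ) (hw : 0 < w) (hh : 0 < h),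
        RandomPlanarGeometry.KlebanZagier.lamR (h / w) = RandomPlanarGeometry.crossRatio x ∧
        ∃ ψ : ConformalEquiv (Percolation.rectQuad 0 w 0 h hw hh).carrier R.carrier,
          (∀ z ∈ (Percolation.rectQuad 0 w 0 h hw hh).arc 0, ∃ p ∈ R.arc 0,
            ψ.HasBoundaryValue z p) ∧
          (∀ z ∈ (Percolation.rectQuad 0 w 0 h hw hh).arc 2, ∃ p ∈ R.arc 2,
            ψ.HasBoundaryValue z p) ∧
          (∀ p ∈ R.arc 0, ∃ z ∈ (Percolation.rectQuad 0 w 0 h hw hh).arc 0,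
            ψ.symm.HasBoundaryValue p z) ∧
          (∀ p ∈ R.arc 2, ∃ z ∈ (Percolation.rectQuad 0 w 0 h hw hh).arc 2,
            ψ.symm.HasBoundaryValue p z) := by
  intro R φ x hux
  -- (1) the aspect ratio
  obtain ⟨m, hm, hlam⟩ :=
    exists_lamR_eq (ConformalRectangle.crossRatio_mem_Ioo_of_isUniformizing hux)
  refine ⟨1, m, one_pos, hm, by rwa [div_one], ?_⟩
  set S := Percolation.rectQuad 0 1 0 m one_pos hm with hS
  -- (3) uniformizing data with arc correspondence for `S` and `R`
  obtain ⟨φS, ξ, huS, hSarc⟩ := S.exists_uniformizing_arcCorrespondence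
  obtain ⟨φR, y, huR, hRarc⟩ := R.exists_uniformizing_arcCorrespondence
  obtain ⟨hS0, hS0'⟩ := hSarc 0 1 (Percolation.SquareModel.nextMark_zero S)
  obtain ⟨hS2, hS2'⟩ := hSarc 2 3 (Percolation.SquareModel.nextMark_two S)
  obtain ⟨hR0, hR0'⟩ := hRarc 0 1 (Percolation.SquareModel.nextMark_zero R)
  obtain ⟨hR2, hR2'⟩ := hRarc 2 3 (Percolation.SquareModel.nextMark_two R)
  -- (2) the two data have the same cross-ratio
  have hcr : RandomPlanarGeometry.crossRatio ξ = RandomPlanarGeometry.crossRatio y := by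
    rw [rectQuad_crossRatio_eq_lamR one_pos hm φS ξ huS, div_one, hlam]
    exact ConformalRectangle.crossRatio_eq_of_isUniformizing_holds hux huR
  -- (4) the Möbius matching of the real marks
  obtain ⟨a, b, c, d, hdet, h01, h23, h01', h23'⟩ :=
    RandomPlanarGeometry.exists_moebius_match ξ y huS.1 huR.1 hcr
  have hdet' : 0 < d * a - -b * -c := by linarith
  obtain ⟨M, hM, hMsymm⟩ := RandomPlanarGeometry.exists_moebius_conformalEquiv hdet
  -- (5) the composite `ψ = φ_R ∘ M ∘ φ_S⁻¹` and its boundary values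
  have fwd : ∀ {A B : Set ℂ} {B' : Set ℝ},
      (∀ z ∈ A, ∃ r ∈ B', Tendsto φS.symm (𝓝[S.carrier] z) (𝓝[upperHalfPlaneSet] (r : ℂ))) →
      (∀ t ∈ B', c * t + d ≠ 0 ∧ ∃ p ∈ B,
        Tendsto φR (𝓝[upperHalfPlaneSet] (((a * t + b) / (c * t + d) : ℝ) : ℂ)) (𝓝 p)) →
      ∀ z ∈ A, ∃ p ∈ B, (φS.symm.trans (M.trans φR)).HasBoundaryValue z p := by
    intro A B B' hA hB z hz
    obtain ⟨r, hr, h1⟩ := hA z hz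
    obtain ⟨hden, p, hp, h3⟩ := hB r hr
    refine ⟨p, hp, ?_⟩
    have h := h3.comp ((RandomPlanarGeometry.moebius_tendsto_ofReal hdet hden).comp h1)
    refine h.congr fun v => ?_
    simp only [Function.comp_apply, ConformalEquiv.trans_apply, hM]
  have bwd : ∀ {A B : Set ℂ} {B' : Set ℝ},
      (∀ p ∈ B, ∃ u ∈ B', Tendsto φR.symm (𝓝[R.carrier] p) (𝓝[upperHalfPlaneSet] (u : ℂ))) →
      (∀ u ∈ B', -c * u + a ≠ 0 ∧ ∃ z ∈ A,
        Tendsto φS (𝓝[upperHalfPlaneSet] (((d * u + -b) / (-c * u + a) : ℝ) : ℂ)) (𝓝 z)) →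
      ∀ p ∈ B, ∃ z ∈ A, (φS.symm.trans (M.trans φR)).symm.HasBoundaryValue p z := by
    intro A B B' hB hA p hp
    obtain ⟨u, hu, h1⟩ := hB p hp
    obtain ⟨hden, z, hz, h3⟩ := hA u hu
    refine ⟨z, hz, ?_⟩
    have h := h3.comp ((RandomPlanarGeometry.moebius_tendsto_ofReal hdet' hden).comp h1)
    refine h.congr fun v => ?_
    simp only [Function.comp_apply]
    show φS (((d : ℂ) * φR.symm v + ((-b : ℝ) : ℂ)) / (((-c : ℝ) : ℂ) * φR.symm v + a)) =
      φS (M.symm (φR.symm v))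
    rw [hMsymm]
  refine ⟨φS.symm.trans (M.trans φR), ?_, ?_, ?_, ?_⟩
  · exact fwd hS0 fun t ht => ⟨(h01 t ht).1, hR0' _ (h01 t ht).2⟩
  · exact fwd hS2 fun t ht => ⟨(h23 t ht).1, hR2' _ (h23 t ht).2⟩
  · exact bwd hR0 fun u hu => ⟨(h01' u hu).1, hS0' _ (h01' u hu).2⟩
  · exact bwd hR2 fun u hu => ⟨(h23' u hu).1, hS2' _ (h23' u hu).2⟩

end Summit.CriticalPhenomena.CardyFormulaZ2.Theorems
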